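import Summits.QuantumAdvantage.AdviceFreeQNC0.LinFormsOrthogonality
import Summits.QuantumAdvantage.AdviceFreeQNC0.LinFormsRegular
import HarnessLib

/-!
# R11' assembly, main term: the junta part of the cell expansion re-indexes into junta strategies

For `K` forms `λ`, a coordinate set `J`, the junta subgroup `Γ_J` (`LinForms.gammaJ`) and its annihilator `Γ_J^⊥` (`perp`):
* `card_gammaJ_mul_card_perp`: `|Γ_J|·|Γ_J^⊥| = p^K` (double counting with characters);
* `dot_resVec_sub_juntaVec`: `V(u) − V_J(u) ⊥ Γ_J` (the off-`J` part of the residue vector is invisible to `Γ_J`);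
* `sum_perp_cells_eq`: for each input `u`, `Σ_v [V(u) − v ⊥ Γ_J]·W(v) = Σ_{δ ∈ Γ_J^⊥} W(V_J(u) + δ)`;
so the main term of PROVER3-MEMO-gen9 §4 is `p^{-K}|Γ_J| Σ_{δ ∈ Γ_J^⊥} #WIN(z_δ)` with the `J`-JUNTA strategies
`z_δ,g(u) = tab g (V_J(u) + δ)` (`main_term_le`: `≤ θ·2ⁿ` whenever every `J`-junta strategy wins `≤ θ·2ⁿ`).
WHAT THIS IS NOT: the error term and the parameter choice (file `WalkHardFLinForms.lean`); separation NOT moved.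
-/

noncomputable section

namespace Summit.QuantumAdvantage.AdviceFreeQNC0

open Finset

namespace LinForms

variable {n K : ℕ} {p : ℕ} [Fact p.Prime]

/-- The annihilator `Γ_J^⊥ = {x : ⟨γ, x⟩ = 0 ∀ γ ∈ Γ_J}`. -/
def perp (lam : Fin K → Fin n → ZMod p) (J : Finset (Fin n)) : Finset (Fin K → ZMod p) :=
  univ.filter fun x => ∀ γ ∈ gammaJ lam J, dot γ x = 0

/-- Membership in `Γ_J^⊥`. -/
theorem mem_perp {lam : Fin K → Fin n → ZMod p} {J : Finset (Fin n)} {x : Fin K → ZMod p} :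
    x ∈ perp lam J ↔ ∀ γ ∈ gammaJ lam J, dot γ x = 0 := by
  unfold perp; simp

/-- The pairing is additive in `x`. -/
theorem dot_add_right (γ x x' : Fin K → ZMod p) : dot γ (x + x') = dot γ x + dot γ x' := by
  unfold dot; rw [← Finset.sum_add_distrib]; exact Finset.sum_congr rfl fun j _ => by simp [mul_add]

/-- The pairing is symmetric. -/
theorem dot_comm (γ x : Fin K → ZMod p) : dot γ x = dot x γ := by
  unfold dot; exact Finset.sum_congr rfl fun j _ => mul_comm _ _

/-- **`|Γ_J|·|Γ_J^⊥| = p^K`** (double counting `Σ_x Σ_{γ ∈ Γ_J} χ(⟨γ,x⟩)` with the two orthogonality relations). -/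
theorem card_gammaJ_mul_card_perp (lam : Fin K → Fin n → ZMod p) (J : Finset (Fin n)) :
    ((gammaJ lam J).card : ℂ) * ((perp lam J).card : ℂ) = (p : ℂ) ^ K := by
  classical
  have h1 : (∑ x : Fin K → ZMod p, ∑ γ ∈ gammaJ lam J, (ZMod.stdAddChar (dot γ x) : ℂ)) =
      ((gammaJ lam J).card : ℂ) * ((perp lam J).card : ℂ) := by
    simp_rw [sum_gammaJ_char]
    rw [Finset.sum_ite, Finset.sum_const_zero, add_zero, Finset.sum_const, nsmul_eq_mul, mul_comm]
    unfold perp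
    rfl
  have h2 : (∑ x : Fin K → ZMod p, ∑ γ ∈ gammaJ lam J, (ZMod.stdAddChar (dot γ x) : ℂ)) = (p : ℂ) ^ K := by
    rw [Finset.sum_comm]
    have hγ : ∀ γ ∈ gammaJ lam J, (∑ x : Fin K → ZMod p, (ZMod.stdAddChar (dot γ x) : ℂ)) =
        if γ = 0 then (p : ℂ) ^ K else 0 := by
      intro γ _
      simp_rw [dot_comm γ]
      exact Literature.Computability.MetaComplexity.TwoModuli.sum_stdAddChar_dot_eq_ite (p := p) γ
    rw [Finset.sum_congr rfl hγ, Finset.sum_ite_eq' (gammaJ lam J) 0 (fun _ => (p : ℂ) ^ K), if_pos]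
    rw [mem_gammaJ]; intro i _; simp
  rw [← h1, h2]

/-- The residue vector of the forms restricted to `J` (the junta part). -/
def juntaVec (lam : Fin K → Fin n → ZMod p) (J : Finset (Fin n)) (u : Fin n → Bool) : Fin K → ZMod p :=
  fun j => ∑ i, if (i ∈ J ∧ u i = true) then lam j i else 0

/-- The off-`J` part of the residue vector is annihilated by `Γ_J`. -/
theorem dot_resVec_sub_juntaVec (lam : Fin K → Fin n → ZMod p) (J : Finset (Fin n)) (u : Fin n → Bool)
    {γ : Fin K → ZMod p} (hγ : γ ∈ gammaJ lam J) : dot γ (resVec lam u - juntaVec lam J u) = 0 := by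
  rw [mem_gammaJ] at hγ
  unfold dot resVec juntaVec
  have hterm : ∀ j, γ j * ((∑ i, if u i then lam j i else 0) - ∑ i, if (i ∈ J ∧ u i = true) then lam j i else 0) =
      ∑ i, if (i ∉ J ∧ u i = true) then γ j * lam j i else 0 := by
    intro j
    rw [← Finset.sum_sub_distrib, Finset.mul_sum]
    refine Finset.sum_congr rfl fun i _ => ?_
    by_cases hu : u i = true <;> by_cases hi : i ∈ J <;> simp [hu, hi]
  simp_rw [Pi.sub_apply, hterm]
  rw [Finset.sum_comm]
  refine Finset.sum_eq_zero fun i _ => ?_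
  by_cases h : i ∉ J ∧ u i = true
  · rw [Finset.sum_congr rfl (fun j _ => if_pos h)]
    exact hγ i h.1
  · simp [h]

/-- The pairing is odd in `x`. -/
theorem dot_neg (γ y : Fin K → ZMod p) : dot γ (-y) = -dot γ y := by
  unfold dot; rw [← Finset.sum_neg_distrib]; exact Finset.sum_congr rfl fun j _ => by simp [mul_neg]

/-- **Re-indexing of the junta cells**: for each input `u` and any weight `W`,
`Σ_v [V(u) − v ⊥ Γ_J]·W(v) = Σ_{δ ∈ Γ_J^⊥} W(V_J(u) + δ)`. -/
theorem sum_perp_cells_eq (lam : Fin K → Fin n → ZMod p) (J : Finset (Fin n)) (u : Fin n → Bool)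
    (W : (Fin K → ZMod p) → ℂ) :
    (∑ v : Fin K → ZMod p, (if (∀ γ ∈ gammaJ lam J, dot γ (resVec lam u - v) = 0) then W v else 0)) =
      ∑ δ ∈ perp lam J, W (juntaVec lam J u + δ) := by
  classical
  rw [← Finset.sum_filter]
  symm
  refine Finset.sum_nbij (fun δ => juntaVec lam J u + δ) (fun δ hδ => ?_) (fun δ _ δ' _ h => by simpa using h)
    (fun v hv => ?_) (fun δ _ => rfl)
  · rw [mem_perp] at hδ
    rw [mem_filter]
    refine ⟨mem_univ _, fun γ hγ => ?_⟩
    have h1 := dot_resVec_sub_juntaVec lam J u hγ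
    have : resVec lam u - (juntaVec lam J u + δ) = (resVec lam u - juntaVec lam J u) + (-δ) := by abel
    rw [this, dot_add_right, h1, zero_add, dot_neg, hδ γ hγ, neg_zero]
  · rw [Finset.mem_coe, mem_filter] at hv
    refine ⟨v - juntaVec lam J u, ?_, by simp⟩
    rw [Finset.mem_coe, mem_perp]
    intro γ hγ
    have h1 := dot_resVec_sub_juntaVec lam J u hγ
    have h2 := hv.2 γ hγ
    have : v - juntaVec lam J u = (resVec lam u - juntaVec lam J u) + (-(resVec lam u - v)) := by abel
    rw [this, dot_add_right, h1, zero_add, dot_neg, h2, neg_zero]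

/-- The junta strategy `z_δ` reads only the bits of `J`. -/
theorem juntaVec_congr (lam : Fin K → Fin n → ZMod p) (J : Finset (Fin n)) {u v : Fin n → Bool}
    (h : ∀ i ∈ J, u i = v i) : juntaVec lam J u = juntaVec lam J v := by
  funext j
  unfold juntaVec
  refine Finset.sum_congr rfl fun i _ => ?_
  by_cases hi : i ∈ J
  · rw [h i hi]
  · simp [hi]

/-- **Main term bound**: if every `J`-junta strategy wins on at most `θ·2ⁿ` inputs, then
`Σ_v Σ_u [V(u) − v ⊥ Γ_J]·[WIN_{Y_v}(u)] ≤ |Γ_J^⊥|·θ·2ⁿ`. -/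
theorem main_term_le (lam : Fin K → Fin n → ZMod p) (J : Finset (Fin n)) (c : ℕ)
    (tab : Fin (n + 1) → (Fin K → ZMod p) → Bool) {θ : ℝ}
    (hJ : ∀ y : Fin (n + 1) → (Fin n → Bool) → Bool, (∀ g, ∀ u v : Fin n → Bool, (∀ i ∈ J, u i = v i) → y g u = y g v) →
      ((univ.filter fun u : Fin n → Bool => ringWinU c y u = true).card : ℝ) ≤ θ * (2 : ℝ) ^ n) :
    ‖∑ v : Fin K → ZMod p, ∑ u : Fin n → Bool,
        (if (∀ γ ∈ gammaJ lam J, dot γ (resVec lam u - v) = 0) then winC c tab v u else 0)‖ ≤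
      ((perp lam J).card : ℝ) * (θ * (2 : ℝ) ^ n) := by
  classical
  rw [Finset.sum_comm]
  simp_rw [sum_perp_cells_eq]
  rw [Finset.sum_comm]
  refine (norm_sum_le _ _).trans ?_
  have hδ : ∀ δ ∈ perp lam J, ‖∑ u : Fin n → Bool, winC c tab (juntaVec lam J u + δ) u‖ ≤ θ * (2 : ℝ) ^ n := by
    intro δ _
    -- the junta strategy `z_δ`
    have hwin : ∀ u : Fin n → Bool, winC c tab (juntaVec lam J u + δ) u =
        (if ringWinU c (fun g u' => tab g (juntaVec lam J u' + δ)) u = true then (1 : ℂ) else 0) := by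
      intro u
      unfold winC
      rw [ringWinU_congr c (y := fun g _ => decide (g ∈ cellSet tab (juntaVec lam J u + δ)))
        (y' := fun g u' => tab g (juntaVec lam J u' + δ)) (fun g => by unfold cellSet; simp)]
    simp_rw [hwin]
    rw [← Finset.natCast_card_filter, Complex.norm_natCast]
    exact hJ _ (fun g u v huv => by rw [juntaVec_congr lam J huv])
  calc (∑ δ ∈ perp lam J, ‖∑ u : Fin n → Bool, winC c tab (juntaVec lam J u + δ) u‖)
      ≤ ∑ _δ ∈ perp lam J, θ * (2 : ℝ) ^ n := Finset.sum_le_sum hδ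
    _ = ((perp lam J).card : ℝ) * (θ * (2 : ℝ) ^ n) := by rw [Finset.sum_const, nsmul_eq_mul]

end LinForms

end Summit.QuantumAdvantage.AdviceFreeQNC0

end
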